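import Summits.AtomisticToContinuum.Crystallization.Theses.ChessboardParticlePlanes

/-!
# Crux `LjPlaneChessboard` (stmt-AtomisticToContinuum-6709), line `Sketch` — stub `stub_sumToMin`,
# part 1: layer bookkeeping lemmas

Helper lemmas for `stub_sumToMin` (file `…LjPlaneChessboardSumToMin.lean`, which imports this
one): for a periodic configuration `Q` of `ℝ³` with a period `w` of height `w 2 = c₀` and
next / previous occupied height maps `τu`, `τd` (hypothesis `Hτ` of the stub),

* occupied heights are `c₀ℤ`-invariant (`sumToMin_occ_shift`);
* site sums `h_S(p) = ∑' y ∈ S ∖ {p}, V |p − y|` are translation-covariant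
  (`sumToMin_tsum_shift`), and the period-2 restack `R(t,t')` of two layers shifts with the
  vertical period, `R(t + kc₀, t' + kc₀) = R(t,t') + kw` (`sumToMin_mem_restack_shift`,
  `sumToMin_restack_siteSum_shift`);
* the class map of one vertical period, `θ = toIcoMod c₀ t₀`, `κ = toIcoDiv c₀ t₀`
  (`sumToMin_classMap`);
* `τu t` / `τd t` are the least / greatest occupied heights above / below `t`, hence commute with
  the vertical period, `τd ∘ τu = id`, `τu` is injective on occupied heights, and the upper / lower
  restack site sums are covariant along the vertical period
  (`sumToMin_tau_*`, `sumToMin_siteSum_up_shift`, `sumToMin_siteSum_dn_shift`); the closed form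
  `sumToMin_tauShift` of the three layer rules is the registered sub-goal this file proves.

All elementary [folklore]; no definition and no notation is introduced (the restack set and the
site sums are written out, literally as in the registered stub signature).
-/

noncomputable section

namespace Summit.AtomisticToContinuum.Crystallization.Theorems.ChessboardParticlePlanesLjPlaneChessboard

open Literature.MathematicalPhysics.StatisticalMechanics

section Layers

variable {Q : PeriodicConfiguration 3} {c₀ : ℝ} {τu τd : ℝ → ℝ} {w : EuclideanSpace ℝ (Fin 3)}

/-- Integer multiples of a period are periods. [folklore] -/
theorem sumToMin_zsmul_mem (hw : w ∈ Q.lattice) (k : ℤ) : (k : ℝ) • w ∈ Q.lattice := by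
  rw [Int.cast_smul_eq_zsmul]
  exact Q.lattice.smul_mem k hw

/-- The occupied heights are invariant under the height `c₀` of a period. [folklore] -/
theorem sumToMin_occ_shift (hw : w ∈ Q.lattice) (hw2 : w 2 = c₀) {s : ℝ}
    (hs : ∃ x ∈ Q.points, x 2 = s) (k : ℤ) : ∃ x ∈ Q.points, x 2 = s + c₀ * k := by
  obtain ⟨x, hx, rfl⟩ := hs
  refine ⟨x + (k : ℝ) • w, Q.add_mem_points hx (sumToMin_zsmul_mem hw k), ?_⟩
  have : (x + (k : ℝ) • w) 2 = x 2 + k * c₀ := by simp [hw2]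
  rw [this]
  ring

/-- **Covariance of site sums**: `h_{S + u}(p + u) = h_S(p)` (`S' = S + u`). [folklore] -/
theorem sumToMin_tsum_shift (V : ℝ → ℝ) {S S' : Set (EuclideanSpace ℝ (Fin 3))}
    (u p : EuclideanSpace ℝ (Fin 3)) (h : ∀ q, q ∈ S' ↔ q - u ∈ S) :
    ∑' y : {y : EuclideanSpace ℝ (Fin 3) // y ∈ S' ∧ y ≠ p + u}, V (dist (p + u) y.1) =
      ∑' y : {y : EuclideanSpace ℝ (Fin 3) // y ∈ S ∧ y ≠ p}, V (dist p y.1) := by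
  let e : {y : EuclideanSpace ℝ (Fin 3) // y ∈ S ∧ y ≠ p} ≃
      {y : EuclideanSpace ℝ (Fin 3) // y ∈ S' ∧ y ≠ p + u} :=
    { toFun := fun y => ⟨y.1 + u, (h _).2 (by rw [add_sub_cancel_right]; exact y.2.1),
        fun hy => y.2.2 (add_right_cancel hy)⟩
      invFun := fun y => ⟨y.1 - u, (h _).1 y.2.1, fun hy => y.2.2 (eq_add_of_sub_eq hy)⟩
      left_inv := fun y => Subtype.ext (add_sub_cancel_right y.1 u)
      right_inv := fun y => Subtype.ext (sub_add_cancel y.1 u) }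
  calc ∑' y : {y : EuclideanSpace ℝ (Fin 3) // y ∈ S' ∧ y ≠ p + u}, V (dist (p + u) y.1)
      = ∑' y : {y : EuclideanSpace ℝ (Fin 3) // y ∈ S ∧ y ≠ p}, V (dist (p + u) (e y).1) :=
        (Equiv.tsum_eq e (fun y => V (dist (p + u) y.1))).symm
    _ = ∑' y : {y : EuclideanSpace ℝ (Fin 3) // y ∈ S ∧ y ≠ p}, V (dist p y.1) :=
        tsum_congr fun y => by
          show V (dist (p + u) (y.1 + u)) = V (dist p y.1)
          rw [dist_add_right]

/-- **Restacks shift with the vertical period**: `R(t + kc₀, t' + kc₀) = R(t,t') + k w` for a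
period `w` of height `c₀`. [folklore] -/
theorem sumToMin_mem_restack_shift (hw : w ∈ Q.lattice) (hw2 : w 2 = c₀) (t t' : ℝ) (k : ℤ)
    (q : EuclideanSpace ℝ (Fin 3)) :
    q ∈ {p : EuclideanSpace ℝ (Fin 3) | ∃ n : ℤ, ∃ x ∈ Q.points,
        (x 2 = t + c₀ * k ∨ x 2 = t' + c₀ * k) ∧
        p = x + ((2 * (t' + c₀ * k - (t + c₀ * k))) * (n : ℝ)) •
          EuclideanSpace.single (2 : Fin 3) (1 : ℝ)} ↔
    q - (k : ℝ) • w ∈ {p : EuclideanSpace ℝ (Fin 3) | ∃ n : ℤ, ∃ x ∈ Q.points,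
        (x 2 = t ∨ x 2 = t') ∧
        p = x + ((2 * (t' - t)) * (n : ℝ)) • EuclideanSpace.single (2 : Fin 3) (1 : ℝ)} := by
  have hk : t' + c₀ * k - (t + c₀ * k) = t' - t := by ring
  simp only [Set.mem_setOf_eq]
  rw [hk]
  constructor
  · rintro ⟨j, x, hx, hxt, rfl⟩
    refine ⟨j, x - (k : ℝ) • w, ?_, ?_, ?_⟩
    · rw [sub_eq_add_neg]
      exact Q.add_mem_points hx (Q.lattice.neg_mem (sumToMin_zsmul_mem hw k))
    · have e : (x - (k : ℝ) • w) 2 = x 2 - k * c₀ := by simp [hw2]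
      rw [e]
      rcases hxt with h | h
      · left; rw [h]; ring
      · right; rw [h]; ring
    · abel
  · rintro ⟨j, x, hx, hxt, hq⟩
    refine ⟨j, x + (k : ℝ) • w, Q.add_mem_points hx (sumToMin_zsmul_mem hw k), ?_, ?_⟩
    · have e : (x + (k : ℝ) • w) 2 = x 2 + k * c₀ := by simp [hw2]
      rw [e]
      rcases hxt with h | h
      · left; rw [h]; ring
      · right; rw [h]; ring
    · rw [sub_eq_iff_eq_add] at hq
      rw [hq]
      abel

/-- Site sums of restacks are covariant under the vertical period:
`h_{R(t + kc₀, t' + kc₀)}(p + kw) = h_{R(t,t')}(p)`. [folklore] -/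
theorem sumToMin_restack_siteSum_shift (hw : w ∈ Q.lattice) (hw2 : w 2 = c₀) (V : ℝ → ℝ)
    (t t' : ℝ) (k : ℤ) (p : EuclideanSpace ℝ (Fin 3)) :
    ∑' y : {y : EuclideanSpace ℝ (Fin 3) //
        y ∈ {q : EuclideanSpace ℝ (Fin 3) | ∃ n : ℤ, ∃ x ∈ Q.points,
          (x 2 = t + c₀ * k ∨ x 2 = t' + c₀ * k) ∧
          q = x + ((2 * (t' + c₀ * k - (t + c₀ * k))) * (n : ℝ)) •
            EuclideanSpace.single (2 : Fin 3) (1 : ℝ)} ∧ y ≠ p + (k : ℝ) • w},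
        V (dist (p + (k : ℝ) • w) y.1) =
      ∑' y : {y : EuclideanSpace ℝ (Fin 3) //
        y ∈ {q : EuclideanSpace ℝ (Fin 3) | ∃ n : ℤ, ∃ x ∈ Q.points, (x 2 = t ∨ x 2 = t') ∧
          q = x + ((2 * (t' - t)) * (n : ℝ)) • EuclideanSpace.single (2 : Fin 3) (1 : ℝ)} ∧
          y ≠ p}, V (dist p y.1) :=
  sumToMin_tsum_shift V ((k : ℝ) • w) p (sumToMin_mem_restack_shift hw hw2 t t' k)

/-- One vertical period: the class map `θ = toIcoMod c₀ t₀` and the winding number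
`κ = toIcoDiv c₀ t₀` (`s = θ s + c₀ κ s`, `θ s = θ t ↔ s ≡ t (mod c₀)`, `θ ∘ θ = θ`). [folklore] -/
theorem sumToMin_classMap (hc₀ : 0 < c₀) (t₀ : ℝ) :
    ∃ (θ : ℝ → ℝ) (κ : ℝ → ℤ), (∀ s, θ s + c₀ * κ s = s) ∧
      (∀ s t, (∃ k : ℤ, s = t + c₀ * k) ↔ θ s = θ t) ∧ (∀ s, θ (θ s) = θ s) := by
  refine ⟨toIcoMod hc₀ t₀, toIcoDiv hc₀ t₀, fun s => ?_, fun s t => ?_,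
    fun s => toIcoMod_toIcoMod hc₀ t₀ t₀ s⟩
  · have h := toIcoMod_add_toIcoDiv_zsmul hc₀ t₀ s
    rwa [zsmul_eq_mul, mul_comm] at h
  · rw [toIcoMod_eq_toIcoMod]
    constructor
    · rintro ⟨k, hk⟩
      exact ⟨-k, by rw [zsmul_eq_mul]; push_cast; linear_combination -hk⟩
    · rintro ⟨n, hn⟩
      exact ⟨-n, by rw [zsmul_eq_mul] at hn; push_cast; linear_combination -hn⟩

variable (Hτ : ∀ t : ℝ, (∃ x ∈ Q.points, x 2 = t) →
    (t < τu t ∧ (∃ x ∈ Q.points, x 2 = τu t) ∧ (∀ x ∈ Q.points, x 2 ≤ t ∨ τu t ≤ x 2)) ∧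
    (τd t < t ∧ (∃ x ∈ Q.points, x 2 = τd t) ∧ (∀ x ∈ Q.points, x 2 ≤ τd t ∨ t ≤ x 2)))
include Hτ

/-- `τu t` is the LEAST occupied height above the occupied height `t`. [folklore] -/
theorem sumToMin_tau_up_le {t s : ℝ} (ht : ∃ x ∈ Q.points, x 2 = t)
    (hs : ∃ x ∈ Q.points, x 2 = s) (hts : t < s) : τu t ≤ s := by
  obtain ⟨x, hx, rfl⟩ := hs
  rcases (Hτ _ ht).1.2.2 x hx with h | h
  · exact absurd h (not_le.2 hts)
  · exact h

/-- `τd t` is the GREATEST occupied height below the occupied height `t`. [folklore] -/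
theorem sumToMin_le_tau_dn {t s : ℝ} (ht : ∃ x ∈ Q.points, x 2 = t)
    (hs : ∃ x ∈ Q.points, x 2 = s) (hst : s < t) : s ≤ τd t := by
  obtain ⟨x, hx, rfl⟩ := hs
  rcases (Hτ _ ht).2.2.2 x hx with h | h
  · exact h
  · exact absurd h (not_le.2 hst)

/-- Previous-of-next is the identity on occupied heights: `τd (τu t) = t`. [folklore] -/
theorem sumToMin_tau_dn_up {t : ℝ} (ht : ∃ x ∈ Q.points, x 2 = t) : τd (τu t) = t := by
  have hu := (Hτ t ht).1
  have hd := (Hτ (τu t) hu.2.1).2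
  refine le_antisymm ?_ (sumToMin_le_tau_dn Hτ hu.2.1 ht hu.1)
  obtain ⟨x, hx, hx2⟩ := hd.2.1
  rcases hu.2.2 x hx with h | h
  · rwa [hx2] at h
  · rw [hx2] at h
    exact absurd h (not_le.2 hd.1)

/-- `τu` commutes with the vertical period: `τu (t + kc₀) = τu t + kc₀`. [folklore] -/
theorem sumToMin_tau_up_shift (hw : w ∈ Q.lattice) (hw2 : w 2 = c₀) {t : ℝ}
    (ht : ∃ x ∈ Q.points, x 2 = t) (k : ℤ) : τu (t + c₀ * k) = τu t + c₀ * k := by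
  have htk := sumToMin_occ_shift hw hw2 ht k
  refine le_antisymm ?_ ?_
  · exact sumToMin_tau_up_le Hτ htk (sumToMin_occ_shift hw hw2 (Hτ t ht).1.2.1 k)
      (by linarith [(Hτ t ht).1.1])
  · have h1 := sumToMin_occ_shift hw hw2 (Hτ _ htk).1.2.1 (-k)
    have h2 : t < τu (t + c₀ * k) + c₀ * ((-k : ℤ) : ℝ) := by
      have := (Hτ _ htk).1.1
      push_cast
      linarith
    have := sumToMin_tau_up_le Hτ ht h1 h2
    push_cast at this
    linarith

/-- `τd` commutes with the vertical period: `τd (t + kc₀) = τd t + kc₀`. [folklore] -/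
theorem sumToMin_tau_dn_shift (hw : w ∈ Q.lattice) (hw2 : w 2 = c₀) {t : ℝ}
    (ht : ∃ x ∈ Q.points, x 2 = t) (k : ℤ) : τd (t + c₀ * k) = τd t + c₀ * k := by
  have htk := sumToMin_occ_shift hw hw2 ht k
  refine le_antisymm ?_ ?_
  · have h1 := sumToMin_occ_shift hw hw2 (Hτ _ htk).2.2.1 (-k)
    have h2 : τd (t + c₀ * k) + c₀ * ((-k : ℤ) : ℝ) < t := by
      have := (Hτ _ htk).2.1
      push_cast
      linarith
    have := sumToMin_le_tau_dn Hτ ht h1 h2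
    push_cast at this
    linarith
  · exact sumToMin_le_tau_dn Hτ htk (sumToMin_occ_shift hw hw2 (Hτ t ht).2.2.1 k)
      (by linarith [(Hτ t ht).2.1])

/-- `τu` is injective on occupied heights. [folklore] -/
theorem sumToMin_tau_up_inj {t t' : ℝ} (ht : ∃ x ∈ Q.points, x 2 = t)
    (ht' : ∃ x ∈ Q.points, x 2 = t') (h : τu t = τu t') : t = t' := by
  rw [← sumToMin_tau_dn_up Hτ ht, h, sumToMin_tau_dn_up Hτ ht']

/-- Upper restack site sums are covariant along the vertical period:
`h_{R(s + kc₀, τu (s + kc₀))}(p + kw) = h_{R(s, τu s)}(p)` for occupied `s`. [folklore] -/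
theorem sumToMin_siteSum_up_shift (hw : w ∈ Q.lattice) (hw2 : w 2 = c₀) (V : ℝ → ℝ) {s : ℝ}
    (hs : ∃ x ∈ Q.points, x 2 = s) (k : ℤ) (p : EuclideanSpace ℝ (Fin 3)) :
    ∑' y : {y : EuclideanSpace ℝ (Fin 3) //
        y ∈ {q : EuclideanSpace ℝ (Fin 3) | ∃ n : ℤ, ∃ x ∈ Q.points,
          (x 2 = s + c₀ * k ∨ x 2 = τu (s + c₀ * k)) ∧
          q = x + ((2 * (τu (s + c₀ * k) - (s + c₀ * k))) * (n : ℝ)) •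
            EuclideanSpace.single (2 : Fin 3) (1 : ℝ)} ∧ y ≠ p + (k : ℝ) • w},
        V (dist (p + (k : ℝ) • w) y.1) =
      ∑' y : {y : EuclideanSpace ℝ (Fin 3) //
        y ∈ {q : EuclideanSpace ℝ (Fin 3) | ∃ n : ℤ, ∃ x ∈ Q.points, (x 2 = s ∨ x 2 = τu s) ∧
          q = x + ((2 * (τu s - s)) * (n : ℝ)) • EuclideanSpace.single (2 : Fin 3) (1 : ℝ)} ∧
          y ≠ p}, V (dist p y.1) := by
  rw [sumToMin_tau_up_shift Hτ hw hw2 hs k]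
  exact sumToMin_restack_siteSum_shift hw hw2 V s (τu s) k p

/-- Lower restack site sums are covariant along the vertical period:
`h_{R(τd (s + kc₀), s + kc₀)}(p + kw) = h_{R(τd s, s)}(p)` for occupied `s`. [folklore] -/
theorem sumToMin_siteSum_dn_shift (hw : w ∈ Q.lattice) (hw2 : w 2 = c₀) (V : ℝ → ℝ) {s : ℝ}
    (hs : ∃ x ∈ Q.points, x 2 = s) (k : ℤ) (p : EuclideanSpace ℝ (Fin 3)) :
    ∑' y : {y : EuclideanSpace ℝ (Fin 3) //
        y ∈ {q : EuclideanSpace ℝ (Fin 3) | ∃ n : ℤ, ∃ x ∈ Q.points,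
          (x 2 = τd (s + c₀ * k) ∨ x 2 = s + c₀ * k) ∧
          q = x + ((2 * (s + c₀ * k - τd (s + c₀ * k))) * (n : ℝ)) •
            EuclideanSpace.single (2 : Fin 3) (1 : ℝ)} ∧ y ≠ p + (k : ℝ) • w},
        V (dist (p + (k : ℝ) • w) y.1) =
      ∑' y : {y : EuclideanSpace ℝ (Fin 3) //
        y ∈ {q : EuclideanSpace ℝ (Fin 3) | ∃ n : ℤ, ∃ x ∈ Q.points, (x 2 = τd s ∨ x 2 = s) ∧
          q = x + ((2 * (s - τd s)) * (n : ℝ)) • EuclideanSpace.single (2 : Fin 3) (1 : ℝ)} ∧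
          y ≠ p}, V (dist p y.1) := by
  rw [sumToMin_tau_dn_shift Hτ hw hw2 hs k]
  exact sumToMin_restack_siteSum_shift hw hw2 V (τd s) s k p

end Layers

/-- **Registered sub-goal `sumToMin_tauShift` of the `stub_sumToMin` bookkeeping** (closed form of
the layer rules above, all binders explicit): for a periodic configuration `Q` with next / previous
occupied height maps `τu`, `τd` and a period `w` of height `c₀`, the maps `τu`, `τd` commute with
the vertical period on occupied heights, `τu (t + kc₀) = τu t + kc₀`, `τd (t + kc₀) = τd t + kc₀`,
and `τd (τu t) = t`. [folklore] -/
theorem sumToMin_tauShift :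
    ∀ (Q : PeriodicConfiguration 3) (c₀ : ℝ) (τu τd : ℝ → ℝ) (w : EuclideanSpace ℝ (Fin 3)),
      (∀ t : ℝ, (∃ x ∈ Q.points, x 2 = t) →
        (t < τu t ∧ (∃ x ∈ Q.points, x 2 = τu t) ∧ (∀ x ∈ Q.points, x 2 ≤ t ∨ τu t ≤ x 2)) ∧
        (τd t < t ∧ (∃ x ∈ Q.points, x 2 = τd t) ∧ (∀ x ∈ Q.points, x 2 ≤ τd t ∨ t ≤ x 2))) →
      w ∈ Q.lattice → w 2 = c₀ → ∀ (t : ℝ) (k : ℤ), (∃ x ∈ Q.points, x 2 = t) →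
        τu (t + c₀ * k) = τu t + c₀ * k ∧ τd (t + c₀ * k) = τd t + c₀ * k ∧ τd (τu t) = t :=
  fun _ _ _ _ _ Hτ hw hw2 _ k ht =>
    ⟨sumToMin_tau_up_shift Hτ hw hw2 ht k, sumToMin_tau_dn_shift Hτ hw hw2 ht k,
      sumToMin_tau_dn_up Hτ ht⟩

end Summit.AtomisticToContinuum.Crystallization.Theorems.ChessboardParticlePlanesLjPlaneChessboard

end
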